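import Summits.CriticalPhenomena.PercolationContinuityZ3.Theorems.PercNearOneGluingNoHeavyQuantFourDisplays
import HarnessLib

/-!
# QUANT lane / PAPER-2 rate track (ARM-2 = constants bookkeeper, gen 6): the Peierls constant `2⁻⁴` in the dimensions `d = 7, 8, 9, 10` —
# orbit defects `η(2⁻⁴, d)` to the last binary digit and the numeral displays `π_{p_c(ℤ^d)}(N) ≤ (1 − 2^{−a_d})^⌊(log*₂ N − 6)/2⌋`,
# `a₇ = 83495`, `a₈ = 192237`, `a₉ = 435334`, `a₁₀ = 973040`

builds on p205010 (kernel theorem, internal audit signed; external expert review pending)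

Cell `prim-quant`, seat `prim-quant-arm-2` (`run/shared/lean/prim/quant/prim-quant-arm-2/RATE-CONSTANTS.md` §2h).  Completes the `2⁻⁴` table of
`…QuantFourDisplays` (`d = 3..6` sharp, `a_d = 2141, 5791, 14645, 35488`, and every `3 ≤ d ≤ 32` in closed form) over the remaining dimensions
of the numeral table (`…QuantFiveDisplaysMidD` p254208 had `89216, 205313, 464755, 1038420` at `2⁻⁵`; `…QuantSixDisplaysMidD` p250578 at `2⁻⁶`;
`…QuantPkOrbitMidD` p249293 at `2⁻⁸`):

* orbit defects (generic cast form `EpsSharp.epsOrbitDefect_half_pow_castForm` at `K(2⁻⁴) = 2485`, two kernel-decided integer comparisons each; interval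
  values `83494.32`, `192236.18`, `435333.13`, `973039.10`): `orbit_four_seven/eight/nine/ten_sharp`;
* displays (`fourScaleDefect_criticalProbI_orbit` + bridge `epsLHi_le_knLHi` p249770 + `knShiftC_eq_six_of_le32` p249070 through the schema p246289):
  `oneArm_rate_Z7..Z10_four_sharp`, with the two-sided `θ` forms (`8d² = 392, 512, 648, 800`).

An explicit function tending to `0` and nothing more (iterated-logarithm type); the `★`-circuit count moves the BASE only; class unchanged; honest
sentence unchanged.  No definitions, no sorries; standard axioms.  [cite: KozmaNitzan2024, §4 Theorem 6 (pp. 25–31)] [cite: DuminilcopinKozmaTassion2020, Proposition 1]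
-/

noncomputable section

namespace Summit.CriticalPhenomena.PercolationContinuityZ3.Theorems.Quant.EpsSharp

open MeasureTheory Literature.Probability.Percolation Literature.Probability.LatticeModels

/-! ## Orbit defects `η(2⁻⁴, d)`, `d = 7, 8, 9, 10`, to the last binary digit -/

/-- **`d = 7`, `a = 4`: `(1/2)^83495 < η(2⁻⁴, 7) < (1/2)^83494`** (interval value `log₂(1/η) = 83494.32`; at `2⁻⁵`: `89215.08`). [folklore] (numeric) -/
theorem orbit_four_seven_sharp :
    (1 / 2 : ℝ) ^ 83495 < epsOrbitDefect ((1 / 2 : ℝ) ^ 4) 7 ∧ epsOrbitDefect ((1 / 2 : ℝ) ^ 4) 7 < (1 / 2 : ℝ) ^ 83494 := by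
  rw [epsOrbitDefect_half_pow_castForm (by norm_num) 4]
  exact one_div_sandwich_of_nat (A := 2 ^ (7 * 2 ^ 7)) (C := 2 ^ (2 * 4) * ((96 * (7 + 1)) ^ 2 * 200)) (Klo := 2485) (Khi := 2485)
    (K := epsK ((1 / 2 : ℝ) ^ 4)) (n := 2 * (7 * 2 ^ 7)) (a := 83494) (by positivity) (by positivity) (by norm_num)
    epsK_four_eq.ge epsK_four_eq.le (by decide +kernel) (by decide +kernel)

/-- **`d = 8`, `a = 4`: `(1/2)^192237 < η(2⁻⁴, 8) < (1/2)^192236`** (interval value `192236.18`; at `2⁻⁵`: `205312.21`). [folklore] (numeric) -/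
theorem orbit_four_eight_sharp :
    (1 / 2 : ℝ) ^ 192237 < epsOrbitDefect ((1 / 2 : ℝ) ^ 4) 8 ∧ epsOrbitDefect ((1 / 2 : ℝ) ^ 4) 8 < (1 / 2 : ℝ) ^ 192236 := by
  rw [epsOrbitDefect_half_pow_castForm (by norm_num) 4]
  exact one_div_sandwich_of_nat (A := 2 ^ (8 * 2 ^ 8)) (C := 2 ^ (2 * 4) * ((96 * (8 + 1)) ^ 2 * 200)) (Klo := 2485) (Khi := 2485)
    (K := epsK ((1 / 2 : ℝ) ^ 4)) (n := 2 * (8 * 2 ^ 8)) (a := 192236) (by positivity) (by positivity) (by norm_num)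
    epsK_four_eq.ge epsK_four_eq.le (by decide +kernel) (by decide +kernel)

/-- **`d = 9`, `a = 4`: `(1/2)^435334 < η(2⁻⁴, 9) < (1/2)^435333`** (interval value `435333.13`; at `2⁻⁵`: `464754.20`). [folklore] (numeric) -/
theorem orbit_four_nine_sharp :
    (1 / 2 : ℝ) ^ 435334 < epsOrbitDefect ((1 / 2 : ℝ) ^ 4) 9 ∧ epsOrbitDefect ((1 / 2 : ℝ) ^ 4) 9 < (1 / 2 : ℝ) ^ 435333 := by
  rw [epsOrbitDefect_half_pow_castForm (by norm_num) 4]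
  exact one_div_sandwich_of_nat (A := 2 ^ (9 * 2 ^ 9)) (C := 2 ^ (2 * 4) * ((96 * (9 + 1)) ^ 2 * 200)) (Klo := 2485) (Khi := 2485)
    (K := epsK ((1 / 2 : ℝ) ^ 4)) (n := 2 * (9 * 2 ^ 9)) (a := 435333) (by positivity) (by positivity) (by norm_num)
    epsK_four_eq.ge epsK_four_eq.le (by decide +kernel) (by decide +kernel)

/-- **`d = 10`, `a = 4`: `(1/2)^973040 < η(2⁻⁴, 10) < (1/2)^973039`** (interval value `973039.10`; at `2⁻⁵`: `1038419.26`). [folklore] (numeric) -/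
theorem orbit_four_ten_sharp :
    (1 / 2 : ℝ) ^ 973040 < epsOrbitDefect ((1 / 2 : ℝ) ^ 4) 10 ∧ epsOrbitDefect ((1 / 2 : ℝ) ^ 4) 10 < (1 / 2 : ℝ) ^ 973039 := by
  rw [epsOrbitDefect_half_pow_castForm (by norm_num) 4]
  exact one_div_sandwich_of_nat (A := 2 ^ (10 * 2 ^ 10)) (C := 2 ^ (2 * 4) * ((96 * (10 + 1)) ^ 2 * 200)) (Klo := 2485) (Khi := 2485)
    (K := epsK ((1 / 2 : ℝ) ^ 4)) (n := 2 * (10 * 2 ^ 10)) (a := 973039) (by positivity) (by positivity) (by norm_num)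
    epsK_four_eq.ge epsK_four_eq.le (by decide +kernel) (by decide +kernel)

/-! ## Displays `d = 7, 8, 9, 10` at the Peierls constant `2⁻⁴` -/

/-- **`ℤ⁷` at `2⁻⁴`**: `π_{p_c(ℤ⁷)}(N) ≤ (1 − 2⁻⁸³⁴⁹⁵)^⌊(log*₂ N − 6)/2⌋` (at `2⁻⁵`: `2⁻⁸⁹²¹⁶`, p254208).  An explicit function tending to `0` and nothing more.
builds on p205010 (kernel theorem, internal audit signed; external expert review pending). [cite: KozmaNitzan2024, §4 Theorem 6] -/
theorem oneArm_rate_Z7_four_sharp (N : ℕ) :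
    oneArmProb 7 (criticalProbI 7) N ≤ (1 - (1 / 2 : ℝ) ^ 83495) ^ ((logStar 2 N - 6) / 2) :=
  PkSharp.oneArm_le_base_pow_of_scaleDefect (by norm_num) (fourScaleDefect_criticalProbI_orbit (d := 7) (by norm_num)) (fun m => le_epsLHi _ 7 m)
    (fun m => epsLHi_le_knLHi (d := 7) (by norm_num) knEps_le_half_pow_four (by norm_num) m) (by positivity) orbit_four_seven_sharp.1.le
    (epsOrbitDefect_half_pow_le_one (by norm_num) 4) (knShiftC_eq_six_of_le32 (d := 7) (by norm_num) (by norm_num)).le N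

/-- **`ℤ⁷` at `2⁻⁴`, `θ` two-sided**: `p − p_c ≤ θ(p) ≤ 2(1 − 2⁻⁸³⁴⁹⁵)^⌊(log*₂ n − 6)/2⌋ + 392(2n+1)⁷(p − p_c)²` on `[p_c, p_c + 1/4]`.
builds on p205010 (kernel theorem, internal audit signed; external expert review pending). [cite: DuminilCopinTassionEM2016, Thm. 1.1(2)] -/
theorem theta_two_sided_Z7_four_sharp (p : unitInterval) (hpc : (criticalProbI 7 : ℝ) ≤ p) (hp : (p : ℝ) ≤ criticalProbI 7 + 1 / 4) (n : ℕ) :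
    (p : ℝ) - criticalProbI 7 ≤ theta (zdGraph 7) 0 p ∧
      theta (zdGraph 7) 0 p ≤ 2 * (1 - (1 / 2 : ℝ) ^ 83495) ^ ((logStar 2 n - 6) / 2) +
        392 * (2 * n + 1 : ℝ) ^ 7 * ((p : ℝ) - criticalProbI 7) ^ 2 := by
  obtain ⟨hlo, hhi⟩ := PkSharp.theta_two_sided_of_scaleDefect (d := 7) (by norm_num) (fourScaleDefect_criticalProbI_orbit (d := 7) (by norm_num))
    (fun m => le_epsLHi _ 7 m) (fun m => epsLHi_le_knLHi (d := 7) (by norm_num) knEps_le_half_pow_four (by norm_num) m) (by positivity)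
    orbit_four_seven_sharp.1.le (epsOrbitDefect_half_pow_le_one (by norm_num) 4) (knShiftC_eq_six_of_le32 (d := 7) (by norm_num) (by norm_num)).le
    p hpc hp n
  refine ⟨hlo, ?_⟩
  have e : (8 : ℝ) * ((7 : ℕ) : ℝ) ^ 2 = 392 := by norm_num
  rw [e] at hhi
  exact hhi

/-- **`ℤ⁸` at `2⁻⁴`**: `π_{p_c(ℤ⁸)}(N) ≤ (1 − 2⁻¹⁹²²³⁷)^⌊(log*₂ N − 6)/2⌋` (at `2⁻⁵`: `2⁻²⁰⁵³¹³`).  An explicit function tending to `0` and nothing more.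
builds on p205010 (kernel theorem, internal audit signed; external expert review pending). [cite: KozmaNitzan2024, §4 Theorem 6] -/
theorem oneArm_rate_Z8_four_sharp (N : ℕ) :
    oneArmProb 8 (criticalProbI 8) N ≤ (1 - (1 / 2 : ℝ) ^ 192237) ^ ((logStar 2 N - 6) / 2) :=
  PkSharp.oneArm_le_base_pow_of_scaleDefect (by norm_num) (fourScaleDefect_criticalProbI_orbit (d := 8) (by norm_num)) (fun m => le_epsLHi _ 8 m)
    (fun m => epsLHi_le_knLHi (d := 8) (by norm_num) knEps_le_half_pow_four (by norm_num) m) (by positivity) orbit_four_eight_sharp.1.le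
    (epsOrbitDefect_half_pow_le_one (by norm_num) 4) (knShiftC_eq_six_of_le32 (d := 8) (by norm_num) (by norm_num)).le N

/-- **`ℤ⁸` at `2⁻⁴`, `θ` two-sided**: `p − p_c ≤ θ(p) ≤ 2(1 − 2⁻¹⁹²²³⁷)^⌊(log*₂ n − 6)/2⌋ + 512(2n+1)⁸(p − p_c)²` on `[p_c, p_c + 1/4]`.
builds on p205010 (kernel theorem, internal audit signed; external expert review pending). [cite: DuminilCopinTassionEM2016, Thm. 1.1(2)] -/
theorem theta_two_sided_Z8_four_sharp (p : unitInterval) (hpc : (criticalProbI 8 : ℝ) ≤ p) (hp : (p : ℝ) ≤ criticalProbI 8 + 1 / 4) (n : ℕ) :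
    (p : ℝ) - criticalProbI 8 ≤ theta (zdGraph 8) 0 p ∧
      theta (zdGraph 8) 0 p ≤ 2 * (1 - (1 / 2 : ℝ) ^ 192237) ^ ((logStar 2 n - 6) / 2) +
        512 * (2 * n + 1 : ℝ) ^ 8 * ((p : ℝ) - criticalProbI 8) ^ 2 := by
  obtain ⟨hlo, hhi⟩ := PkSharp.theta_two_sided_of_scaleDefect (d := 8) (by norm_num) (fourScaleDefect_criticalProbI_orbit (d := 8) (by norm_num))
    (fun m => le_epsLHi _ 8 m) (fun m => epsLHi_le_knLHi (d := 8) (by norm_num) knEps_le_half_pow_four (by norm_num) m) (by positivity)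
    orbit_four_eight_sharp.1.le (epsOrbitDefect_half_pow_le_one (by norm_num) 4) (knShiftC_eq_six_of_le32 (d := 8) (by norm_num) (by norm_num)).le
    p hpc hp n
  refine ⟨hlo, ?_⟩
  have e : (8 : ℝ) * ((8 : ℕ) : ℝ) ^ 2 = 512 := by norm_num
  rw [e] at hhi
  exact hhi

/-- **`ℤ⁹` at `2⁻⁴`**: `π_{p_c(ℤ⁹)}(N) ≤ (1 − 2⁻⁴³⁵³³⁴)^⌊(log*₂ N − 6)/2⌋` (at `2⁻⁵`: `2⁻⁴⁶⁴⁷⁵⁵`).  An explicit function tending to `0` and nothing more.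
builds on p205010 (kernel theorem, internal audit signed; external expert review pending). [cite: KozmaNitzan2024, §4 Theorem 6] -/
theorem oneArm_rate_Z9_four_sharp (N : ℕ) :
    oneArmProb 9 (criticalProbI 9) N ≤ (1 - (1 / 2 : ℝ) ^ 435334) ^ ((logStar 2 N - 6) / 2) :=
  PkSharp.oneArm_le_base_pow_of_scaleDefect (by norm_num) (fourScaleDefect_criticalProbI_orbit (d := 9) (by norm_num)) (fun m => le_epsLHi _ 9 m)
    (fun m => epsLHi_le_knLHi (d := 9) (by norm_num) knEps_le_half_pow_four (by norm_num) m) (by positivity) orbit_four_nine_sharp.1.le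
    (epsOrbitDefect_half_pow_le_one (by norm_num) 4) (knShiftC_eq_six_of_le32 (d := 9) (by norm_num) (by norm_num)).le N

/-- **`ℤ⁹` at `2⁻⁴`, `θ` two-sided**: `p − p_c ≤ θ(p) ≤ 2(1 − 2⁻⁴³⁵³³⁴)^⌊(log*₂ n − 6)/2⌋ + 648(2n+1)⁹(p − p_c)²` on `[p_c, p_c + 1/4]`.
builds on p205010 (kernel theorem, internal audit signed; external expert review pending). [cite: DuminilCopinTassionEM2016, Thm. 1.1(2)] -/
theorem theta_two_sided_Z9_four_sharp (p : unitInterval) (hpc : (criticalProbI 9 : ℝ) ≤ p) (hp : (p : ℝ) ≤ criticalProbI 9 + 1 / 4) (n : ℕ) :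
    (p : ℝ) - criticalProbI 9 ≤ theta (zdGraph 9) 0 p ∧
      theta (zdGraph 9) 0 p ≤ 2 * (1 - (1 / 2 : ℝ) ^ 435334) ^ ((logStar 2 n - 6) / 2) +
        648 * (2 * n + 1 : ℝ) ^ 9 * ((p : ℝ) - criticalProbI 9) ^ 2 := by
  obtain ⟨hlo, hhi⟩ := PkSharp.theta_two_sided_of_scaleDefect (d := 9) (by norm_num) (fourScaleDefect_criticalProbI_orbit (d := 9) (by norm_num))
    (fun m => le_epsLHi _ 9 m) (fun m => epsLHi_le_knLHi (d := 9) (by norm_num) knEps_le_half_pow_four (by norm_num) m) (by positivity)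
    orbit_four_nine_sharp.1.le (epsOrbitDefect_half_pow_le_one (by norm_num) 4) (knShiftC_eq_six_of_le32 (d := 9) (by norm_num) (by norm_num)).le
    p hpc hp n
  refine ⟨hlo, ?_⟩
  have e : (8 : ℝ) * ((9 : ℕ) : ℝ) ^ 2 = 648 := by norm_num
  rw [e] at hhi
  exact hhi

/-- **`ℤ¹⁰` at `2⁻⁴`**: `π_{p_c(ℤ¹⁰)}(N) ≤ (1 − 2⁻⁹⁷³⁰⁴⁰)^⌊(log*₂ N − 6)/2⌋` (at `2⁻⁵`: `2⁻¹⁰³⁸⁴²⁰`).  An explicit function tending to `0` and nothing more.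
builds on p205010 (kernel theorem, internal audit signed; external expert review pending). [cite: KozmaNitzan2024, §4 Theorem 6] -/
theorem oneArm_rate_Z10_four_sharp (N : ℕ) :
    oneArmProb 10 (criticalProbI 10) N ≤ (1 - (1 / 2 : ℝ) ^ 973040) ^ ((logStar 2 N - 6) / 2) :=
  PkSharp.oneArm_le_base_pow_of_scaleDefect (by norm_num) (fourScaleDefect_criticalProbI_orbit (d := 10) (by norm_num)) (fun m => le_epsLHi _ 10 m)
    (fun m => epsLHi_le_knLHi (d := 10) (by norm_num) knEps_le_half_pow_four (by norm_num) m) (by positivity) orbit_four_ten_sharp.1.le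
    (epsOrbitDefect_half_pow_le_one (by norm_num) 4) (knShiftC_eq_six_of_le32 (d := 10) (by norm_num) (by norm_num)).le N

/-- **`ℤ¹⁰` at `2⁻⁴`, `θ` two-sided**: `p − p_c ≤ θ(p) ≤ 2(1 − 2⁻⁹⁷³⁰⁴⁰)^⌊(log*₂ n − 6)/2⌋ + 800(2n+1)¹⁰(p − p_c)²` on `[p_c, p_c + 1/4]`.
builds on p205010 (kernel theorem, internal audit signed; external expert review pending). [cite: DuminilCopinTassionEM2016, Thm. 1.1(2)] -/
theorem theta_two_sided_Z10_four_sharp (p : unitInterval) (hpc : (criticalProbI 10 : ℝ) ≤ p) (hp : (p : ℝ) ≤ criticalProbI 10 + 1 / 4) (n : ℕ) :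
    (p : ℝ) - criticalProbI 10 ≤ theta (zdGraph 10) 0 p ∧
      theta (zdGraph 10) 0 p ≤ 2 * (1 - (1 / 2 : ℝ) ^ 973040) ^ ((logStar 2 n - 6) / 2) +
        800 * (2 * n + 1 : ℝ) ^ 10 * ((p : ℝ) - criticalProbI 10) ^ 2 := by
  obtain ⟨hlo, hhi⟩ := PkSharp.theta_two_sided_of_scaleDefect (d := 10) (by norm_num) (fourScaleDefect_criticalProbI_orbit (d := 10) (by norm_num))
    (fun m => le_epsLHi _ 10 m) (fun m => epsLHi_le_knLHi (d := 10) (by norm_num) knEps_le_half_pow_four (by norm_num) m) (by positivity)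
    orbit_four_ten_sharp.1.le (epsOrbitDefect_half_pow_le_one (by norm_num) 4) (knShiftC_eq_six_of_le32 (d := 10) (by norm_num) (by norm_num)).le
    p hpc hp n
  refine ⟨hlo, ?_⟩
  have e : (8 : ℝ) * ((10 : ℕ) : ℝ) ^ 2 = 800 := by norm_num
  rw [e] at hhi
  exact hhi

end Summit.CriticalPhenomena.PercolationContinuityZ3.Theorems.Quant.EpsSharp

end
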